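import Summits.CriticalPhenomena.PercolationContinuityZ3.Theorems.PercNearOneGluingNoHeavyQuantLongTailTripleHubAlg
import HarnessLib

/-!
# QUANT lane R8, T-DEC: LONG-TAIL TRIPLE HUB BEYOND 3lo — closed forms of the TOP route (census-1 gen 32)

builds on p205010 (kernel theorem, internal audit signed; external expert review pending)

Support file (`--supports stmt-CriticalPhenomena-4575`), QUANT lane seat prim-quant-census-1 (gen 32); memo
`run/shared/lean/prim/quant/prim-quant-census-1/g32/TWOLO-G32.md` §6 (iv).  Theorems only, standard axioms, no sorries.  Pure real-polynomial
inequalities: the certificates of the TWO-BRANCH rule for the width-3 hub `S(γ₁)∗S(γ₂)∗S(γ₃)` of shape `{lo, lo+K; γ}` with `3lo < K ≤ 7lo/2`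
(memo §6 (iv); exp39: 0 failures in 226 000 instances): the low `3lo` goes to `3lo+K` while the credit `(T−6lo)(u₀+u₁) ≤ K·u₁` lasts (floor capacity
`ltTriple_capMid`, cost free), and EVERYTHING charged goes to the top `3lo+3K` afterwards (`T = 6lo + D`; one low `3lo` for `D ≤ 2K`, two lows `3lo`,
`3lo+K` for `D > 2K`).  Notation: `u₀ = (1−g₁)(1−g₂)(1−g₃)`, `u₁ = Σ gᵢ(1−gⱼ)(1−gₖ)`, `u₂ = Σ gᵢgⱼ(1−gₖ)`, `u₃ = g₁g₂g₃`; rate `ρ = D/(3K)` for the low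
`3lo` (and `(D−2K)/(2K) ≤ D/(3K)` for `3lo+K`), budget `u₀(D+3lo) + u₁(D+3lo−K) + u₂(D+3lo−2K)₊`.  Certificates found by kit j296246 (`code/kitjob4`:
scipy/HiGHS float LP for the support + exact rational repair), checked here by `linarith` over explicit products of nonnegative atoms.
* `ltTop_capRho_one` / `ltTop_capRho_two` — ρ-capacity of the top: `D(u₀+u₃) ≤ 3Ku₃` (one low, needs the exhausted credit), `D(u₀+u₁+u₃) ≤ 3Ku₃` (two).
* `ltTop_costRho_oneA` / `ltTop_costRho_oneB` / `ltTop_costRho_two` — ρ-part of the torque cost `(3lo+3K−T)·ρ/(1−ρ)·flow ≤ budget`.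
* `ltTop_capTop_two` — floor capacity with two lows at the largest floor: `(lo+Kg₁)(u₀+u₁+u₃) ≤ (lo+K)u₃`.
* `ltTop_cost0_max` — the floor part of the cost at the switching point `τ = 6lo + K·u₁/(u₀+u₁)`, largest floor (degree 8).
MISSING for the theorem (memo §6 (iv)): the one-low floor capacity `(lo+Kg₁)(u₀+u₃) ≤ (lo+K)u₃` given `(K(g₁+g₂+g₃)−3lo)(u₀+u₁) ≥ K·u₁` and the floor cost
at `T = 6lo+2K` (`Cc2`) — true numerically (exp40, 0 failures), no low-degree Handelman certificate found yet — and the route/hub bookkeeping.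

HONEST STATUS.  Algebra only; `SiblingStep`, `GluedDominatedMass`, `SDECConvClosed`, `FarTreeRow` OPEN; RATE class (log\*) / honest sentence of
`run/shared/lean/prim/quant/README.md` unchanged.  [this work].  Nothing here is cited as a published result.  The gluing rows served
[cite: KozmaNitzan2024, Conjecture 3 (p. 15)]; product measure [cite: Grimmett1999, §1.3 p. 10].
-/

noncomputable section

namespace Summit.CriticalPhenomena.PercolationContinuityZ3.Theorems
namespace Quant
namespace LawDec

/-- **top capacity, ρ-part, one low** (`3lo ≤ K`, gates in `[lo/K,1]`, `0 ≤ D ≤ 2K`, `D ≤ K(g₁+g₂+g₃) − 3lo`, credit exhausted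
`K·u₁ ≤ D(u₀+u₁)`): `D(u₀+u₃) ≤ 3K·u₃`. Degree-4 Handelman certificate (kit j296246). [this work] -/
theorem ltTop_capRho_one (lo K g₁ g₂ g₃ D : ℝ) (hlo : 0 < lo)
    (hK1 : 3 * lo ≤ K) (hK2 : 2 * K ≤ 7 * lo) (hg₁ : lo ≤ K * g₁) (hg₂ : lo ≤ K * g₂) (hg₃ : lo ≤ K * g₃) (h11 : g₁ ≤ 1)
    (h21 : g₂ ≤ 1) (h31 : g₃ ≤ 1) (hD : 0 ≤ D) (hD2' : D ≤ 2 * K) (hDL' : D ≤ K * (g₁ + g₂ + g₃) - 3 * lo)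
    (hcr : K * (g₁ * (1 - g₂) * (1 - g₃) + g₂ * (1 - g₁) * (1 - g₃) + g₃ * (1 - g₁) * (1 - g₂))
      ≤ D * ((1 - g₁) * (1 - g₂) * (1 - g₃) + (g₁ * (1 - g₂) * (1 - g₃) + g₂ * (1 - g₁) * (1 - g₃) + g₃ * (1 - g₁) * (1 - g₂)))) :
    D * ((1 - g₁) * (1 - g₂) * (1 - g₃) + (g₁ * g₂ * g₃))
      ≤ 3 * K * (g₁ * g₂ * g₃) := by
  have hK : 0 < K := by linarith
  have hA1 : 0 ≤ K * g₁ - lo := sub_nonneg.2 hg₁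
  have hA2 : 0 ≤ K * g₂ - lo := sub_nonneg.2 hg₂
  have hA3 : 0 ≤ K * g₃ - lo := sub_nonneg.2 hg₃
  have hE1 : 0 ≤ 1 - g₁ := sub_nonneg.2 h11
  have hE2 : 0 ≤ 1 - g₂ := sub_nonneg.2 h21
  have hE3 : 0 ≤ 1 - g₃ := sub_nonneg.2 h31
  have hClo : 0 ≤ 7 * lo - 2 * K := by linarith
  have hD0 : 0 ≤ D := hD
  have hD2 : 0 ≤ 2 * K - D := by linarith
  have hDL : 0 ≤ K * (g₁ + g₂ + g₃) - 3 * lo - D := sub_nonneg.2 hDL'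
  have hPd : 0 ≤ D * ((1 - g₁) * (1 - g₂) * (1 - g₃) + (g₁ * (1 - g₂) * (1 - g₃) + g₂ * (1 - g₁) * (1 - g₃) + g₃ * (1 - g₁) * (1
          - g₂))) - K * (g₁ * (1 - g₂) * (1 - g₃) + g₂ * (1 - g₁) * (1 - g₃) + g₃ * (1 - g₁) * (1 - g₂)) := sub_nonneg.2 hcr
  have key : 0 ≤ K ^ 3 * (3 * K * (g₁ * g₂ * g₃)
      - (D * ((1 - g₁) * (1 - g₂) * (1 - g₃) + (g₁ * g₂ * g₃)))) := by
    linarith [mul_nonneg (mul_nonneg (mul_nonneg hPd hK.le) hK.le) hK.le,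
      mul_nonneg (mul_nonneg (mul_nonneg hD2 hD2) hDL) hK.le,
      mul_nonneg (mul_nonneg (mul_nonneg hD0 hDL) hK.le) hK.le,
      mul_nonneg (mul_nonneg (mul_nonneg hD0 hD0) hDL) hK.le,
      mul_nonneg (mul_nonneg (mul_nonneg hD0 hD0) hD0) hK.le,
      mul_nonneg (mul_nonneg (mul_nonneg hClo hDL) hK.le) hK.le,
      mul_nonneg (mul_nonneg (mul_nonneg hClo hD2) hDL) hK.le,
      mul_nonneg (mul_nonneg (mul_nonneg hClo hD0) hK.le) hK.le,
      mul_nonneg (mul_nonneg (mul_nonneg hClo hD0) hD2) hK.le,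
      mul_nonneg (mul_nonneg (mul_nonneg hClo hD0) hD2) hDL,
      mul_nonneg (mul_nonneg (mul_nonneg hClo hD0) hD0) hD2,
      mul_nonneg (mul_nonneg (mul_nonneg hClo hClo) hD2) hK.le,
      mul_nonneg (mul_nonneg (mul_nonneg hClo hClo) hD2) hDL,
      mul_nonneg (mul_nonneg (mul_nonneg hClo hClo) hD0) hK.le,
      mul_nonneg (mul_nonneg (mul_nonneg hClo hClo) hD0) hD2,
      mul_nonneg (mul_nonneg (mul_nonneg hClo hClo) hClo) hD2,
      mul_nonneg (mul_nonneg (mul_nonneg (mul_nonneg (mul_nonneg hE2 hE3) hD2) hD2) hK.le) hK.le,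
      mul_nonneg (mul_nonneg (mul_nonneg (mul_nonneg (mul_nonneg hE2 hE3) hD0) hD0) hK.le) hK.le,
      mul_nonneg (mul_nonneg (mul_nonneg (mul_nonneg (mul_nonneg hE2 hE3) hClo) hK.le) hK.le) hK.le,
      mul_nonneg (mul_nonneg (mul_nonneg (mul_nonneg (mul_nonneg hE2 hE3) hClo) hD0) hK.le) hK.le,
      mul_nonneg (mul_nonneg (mul_nonneg (mul_nonneg (mul_nonneg hE1 hE3) hD2) hD2) hK.le) hK.le,
      mul_nonneg (mul_nonneg (mul_nonneg (mul_nonneg (mul_nonneg hE1 hE3) hD0) hD0) hK.le) hK.le,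
      mul_nonneg (mul_nonneg (mul_nonneg (mul_nonneg (mul_nonneg hE1 hE3) hClo) hK.le) hK.le) hK.le,
      mul_nonneg (mul_nonneg (mul_nonneg (mul_nonneg (mul_nonneg hE1 hE3) hClo) hD0) hK.le) hK.le,
      mul_nonneg (mul_nonneg (mul_nonneg (mul_nonneg (mul_nonneg hE1 hE2) hD2) hD2) hK.le) hK.le,
      mul_nonneg (mul_nonneg (mul_nonneg (mul_nonneg (mul_nonneg hE1 hE2) hD0) hD0) hK.le) hK.le,
      mul_nonneg (mul_nonneg (mul_nonneg (mul_nonneg (mul_nonneg hE1 hE2) hClo) hK.le) hK.le) hK.le,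
      mul_nonneg (mul_nonneg (mul_nonneg (mul_nonneg (mul_nonneg hE1 hE2) hClo) hD0) hK.le) hK.le,
      mul_nonneg (mul_nonneg (mul_nonneg (mul_nonneg (mul_nonneg hA3 hE1) hE2) hD0) hK.le) hK.le,
      mul_nonneg (mul_nonneg (mul_nonneg (mul_nonneg (mul_nonneg hA2 hE1) hE3) hD0) hK.le) hK.le,
      mul_nonneg (mul_nonneg (mul_nonneg hA2 hA3) hK.le) hK.le,
      mul_nonneg (mul_nonneg (mul_nonneg hA2 hA3) hD2) hK.le,
      mul_nonneg (mul_nonneg (mul_nonneg hA2 hA3) hD0) hD2,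
      mul_nonneg (mul_nonneg (mul_nonneg hA2 hA3) hClo) hD2,
      mul_nonneg (mul_nonneg (mul_nonneg (mul_nonneg (mul_nonneg hA1 hE2) hE3) hD0) hK.le) hK.le,
      mul_nonneg (mul_nonneg (mul_nonneg hA1 hA3) hK.le) hK.le,
      mul_nonneg (mul_nonneg (mul_nonneg hA1 hA3) hD2) hK.le,
      mul_nonneg (mul_nonneg (mul_nonneg hA1 hA3) hD0) hD2,
      mul_nonneg (mul_nonneg (mul_nonneg hA1 hA3) hClo) hD2,
      mul_nonneg (mul_nonneg (mul_nonneg hA1 hA2) hK.le) hK.le,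
      mul_nonneg (mul_nonneg (mul_nonneg hA1 hA2) hD2) hK.le,
      mul_nonneg (mul_nonneg (mul_nonneg hA1 hA2) hD0) hD2,
      mul_nonneg (mul_nonneg (mul_nonneg hA1 hA2) hClo) hD2,
      mul_nonneg (mul_nonneg (mul_nonneg hA1 hA2) hA3) hD2]
  by_contra hc; push Not at hc
  have := mul_neg_of_pos_of_neg (pow_pos hK 3) (show 3 * K * (g₁ * g₂ * g₃) - (D * ((1 - g₁) * (1 - g₂) * (1 - g₃) + (g₁ * g₂ * g₃))) < 0 by linarith)
  linarith

/-- **top cost, ρ-part, one low, `3lo+2K` above `T`** (`T = 6lo+D`, `K ≤ D+3lo ≤ 2K`): `(3K−3lo−D)·D·u₀ ≤ (3K−D)(u₀(D+3lo) + u₁(D+3lo−K))`.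
Degree-4 certificate, 12 products (kit j296246). [this work] -/
theorem ltTop_costRho_oneA (lo K g₁ g₂ g₃ D : ℝ) (hlo : 0 < lo)
    (hK1 : 3 * lo ≤ K) (hK2 : 2 * K ≤ 7 * lo) (hg₂ : lo ≤ K * g₂) (hg₃ : lo ≤ K * g₃) (h11 : g₁ ≤ 1) (h21 : g₂ ≤ 1)
    (h31 : g₃ ≤ 1) (hD : 0 ≤ D) (hT1' : K ≤ D + 3 * lo) (hT2' : D + 3 * lo ≤ 2 * K)
    (hcr : K * (g₁ * (1 - g₂) * (1 - g₃) + g₂ * (1 - g₁) * (1 - g₃) + g₃ * (1 - g₁) * (1 - g₂))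
      ≤ D * ((1 - g₁) * (1 - g₂) * (1 - g₃) + (g₁ * (1 - g₂) * (1 - g₃) + g₂ * (1 - g₁) * (1 - g₃) + g₃ * (1 - g₁) * (1 - g₂)))) :
    (3 * K - 3 * lo - D) * D * ((1 - g₁) * (1 - g₂) * (1 - g₃))
      ≤ (3 * K - D) * ((1 - g₁) * (1 - g₂) * (1 - g₃) * (D + 3 * lo) + (g₁ * (1 - g₂) * (1 - g₃) + g₂ * (1 - g₁) * (1 - g₃) + g₃ * (1 - g₁) * (1
          - g₂)) * (D + 3 * lo - K)) := by
  have hK : 0 < K := by linarith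
  have hA2 : 0 ≤ K * g₂ - lo := sub_nonneg.2 hg₂
  have hA3 : 0 ≤ K * g₃ - lo := sub_nonneg.2 hg₃
  have hE1 : 0 ≤ 1 - g₁ := sub_nonneg.2 h11
  have hE2 : 0 ≤ 1 - g₂ := sub_nonneg.2 h21
  have hE3 : 0 ≤ 1 - g₃ := sub_nonneg.2 h31
  have hClo : 0 ≤ 7 * lo - 2 * K := by linarith
  have hD0 : 0 ≤ D := hD
  have hPd : 0 ≤ D * ((1 - g₁) * (1 - g₂) * (1 - g₃) + (g₁ * (1 - g₂) * (1 - g₃) + g₂ * (1 - g₁) * (1 - g₃) + g₃ * (1 - g₁) * (1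
          - g₂))) - K * (g₁ * (1 - g₂) * (1 - g₃) + g₂ * (1 - g₁) * (1 - g₃) + g₃ * (1 - g₁) * (1 - g₂)) := sub_nonneg.2 hcr
  have hT1 : 0 ≤ D + 3 * lo - K := by linarith
  have hT2 : 0 ≤ 2 * K - 3 * lo - D := by linarith
  have key : 0 ≤ ((3 * K - D) * ((1 - g₁) * (1 - g₂) * (1 - g₃) * (D + 3 * lo) + (g₁ * (1 - g₂) * (1 - g₃) + g₂ * (1 - g₁) * (1 - g₃) + g₃ * (1
          - g₁) * (1 - g₂)) * (D + 3 * lo - K))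
      - ((3 * K - 3 * lo - D) * D * ((1 - g₁) * (1 - g₂) * (1 - g₃)))) := by
    linarith [mul_nonneg hT2 hPd,
      mul_nonneg (mul_nonneg (mul_nonneg hE2 hE3) hK.le) hK.le,
      mul_nonneg (mul_nonneg (mul_nonneg hE2 hE3) hD0) hT1,
      mul_nonneg (mul_nonneg (mul_nonneg hE2 hE3) hClo) hK.le,
      mul_nonneg (mul_nonneg (mul_nonneg hE1 hE3) hK.le) hK.le,
      mul_nonneg (mul_nonneg (mul_nonneg hE1 hE3) hD0) hT1,
      mul_nonneg (mul_nonneg (mul_nonneg hE1 hE3) hClo) hK.le,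
      mul_nonneg (mul_nonneg (mul_nonneg hE1 hE2) hK.le) hK.le,
      mul_nonneg (mul_nonneg (mul_nonneg hE1 hE2) hT2) hT2,
      mul_nonneg (mul_nonneg (mul_nonneg hE1 hE2) hClo) hK.le,
      mul_nonneg (mul_nonneg (mul_nonneg hA3 hE1) hE2) hT1,
      mul_nonneg (mul_nonneg (mul_nonneg hA2 hE1) hE3) hK.le]
  linarith [key]

/-- **top cost, ρ-part, one low, `3lo+2K` below `T`** (`2K ≤ D+3lo`, `D ≤ 2K`): `(3K−3lo−D)·D·u₀ ≤ (3K−D)(u₀(D+3lo) + u₁(D+3lo−K) + u₂(D+3lo−2K))`.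
Degree-4 certificate, 32 products (kit j296246). [this work] -/
theorem ltTop_costRho_oneB (lo K g₁ g₂ g₃ D : ℝ) (hlo : 0 < lo)
    (hK1 : 3 * lo ≤ K) (hg₁ : lo ≤ K * g₁) (hg₂ : lo ≤ K * g₂) (hg₃ : lo ≤ K * g₃) (h11 : g₁ ≤ 1) (h21 : g₂ ≤ 1) (h31 : g₃ ≤ 1)
    (hD : 0 ≤ D) (hD2' : D ≤ 2 * K) (hT2' : 2 * K ≤ D + 3 * lo) :
    (3 * K - 3 * lo - D) * D * ((1 - g₁) * (1 - g₂) * (1 - g₃))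
      ≤ (3 * K - D) * ((1 - g₁) * (1 - g₂) * (1 - g₃) * (D + 3 * lo) + (g₁ * (1 - g₂) * (1 - g₃) + g₂ * (1 - g₁) * (1 - g₃) + g₃ * (1 - g₁) * (1
          - g₂)) * (D + 3 * lo - K) + (g₁ * g₂ * (1 - g₃) + g₁ * g₃ * (1 - g₂) + g₂ * g₃ * (1 - g₁)) * (D + 3 * lo - 2 * K)) := by
  have hK : 0 < K := by linarith
  have hA1 : 0 ≤ K * g₁ - lo := sub_nonneg.2 hg₁
  have hA2 : 0 ≤ K * g₂ - lo := sub_nonneg.2 hg₂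
  have hA3 : 0 ≤ K * g₃ - lo := sub_nonneg.2 hg₃
  have hE1 : 0 ≤ 1 - g₁ := sub_nonneg.2 h11
  have hE2 : 0 ≤ 1 - g₂ := sub_nonneg.2 h21
  have hE3 : 0 ≤ 1 - g₃ := sub_nonneg.2 h31
  have hD0 : 0 ≤ D := hD
  have hD2 : 0 ≤ 2 * K - D := by linarith
  have hT2 : 0 ≤ D + 3 * lo - 2 * K := by linarith
  have key : 0 ≤ K * ((3 * K - D) * ((1 - g₁) * (1 - g₂) * (1 - g₃) * (D + 3 * lo) + (g₁ * (1 - g₂) * (1 - g₃) + g₂ * (1 - g₁) * (1 - g₃) + g₃ * (1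
          - g₁) * (1 - g₂)) * (D + 3 * lo - K) + (g₁ * g₂ * (1 - g₃) + g₁ * g₃ * (1 - g₂) + g₂ * g₃ * (1 - g₁)) * (D + 3 * lo - 2 * K))
      - ((3 * K - 3 * lo - D) * D * ((1 - g₁) * (1 - g₂) * (1 - g₃)))) := by
    linarith [mul_nonneg (mul_nonneg (mul_nonneg hE3 hT2) hD2) hK.le,
      mul_nonneg (mul_nonneg (mul_nonneg hE3 hT2) hD2) hD2,
      mul_nonneg (mul_nonneg (mul_nonneg hE3 hT2) hT2) hD2,
      mul_nonneg (mul_nonneg (mul_nonneg hE3 hT2) hT2) hT2,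
      mul_nonneg (mul_nonneg (mul_nonneg hE3 hD0) hD0) hT2,
      mul_nonneg (mul_nonneg (mul_nonneg hE2 hT2) hD2) hK.le,
      mul_nonneg (mul_nonneg (mul_nonneg hE2 hT2) hT2) hD2,
      mul_nonneg (mul_nonneg (mul_nonneg hE2 hT2) hT2) hT2,
      mul_nonneg (mul_nonneg (mul_nonneg hE2 hD0) hD0) hT2,
      mul_nonneg (mul_nonneg (mul_nonneg (mul_nonneg hE2 hE3) hD2) hD2) hK.le,
      mul_nonneg (mul_nonneg (mul_nonneg (mul_nonneg hE2 hE3) hD0) hD2) hK.le,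
      mul_nonneg (mul_nonneg (mul_nonneg hE1 hT2) hD2) hD2,
      mul_nonneg (mul_nonneg (mul_nonneg hE1 hT2) hT2) hD2,
      mul_nonneg (mul_nonneg (mul_nonneg hE1 hT2) hT2) hT2,
      mul_nonneg (mul_nonneg (mul_nonneg hE1 hD0) hD0) hT2,
      mul_nonneg (mul_nonneg (mul_nonneg (mul_nonneg hE1 hE3) hD2) hK.le) hK.le,
      mul_nonneg (mul_nonneg (mul_nonneg (mul_nonneg hE1 hE2) hD2) hK.le) hK.le,
      mul_nonneg (mul_nonneg (mul_nonneg (mul_nonneg (mul_nonneg hE1 hE2) hE3) hT2) hK.le) hK.le,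
      mul_nonneg (mul_nonneg (mul_nonneg hA3 hE2) hT2) hD2,
      mul_nonneg (mul_nonneg (mul_nonneg hA3 hE1) hT2) hD2,
      mul_nonneg (mul_nonneg (mul_nonneg hA3 hE1) hT2) hT2,
      mul_nonneg (mul_nonneg (mul_nonneg (mul_nonneg hA3 hE1) hE2) hK.le) hK.le,
      mul_nonneg (mul_nonneg (mul_nonneg hA2 hE3) hT2) hD2,
      mul_nonneg (mul_nonneg (mul_nonneg hA2 hE3) hT2) hT2,
      mul_nonneg (mul_nonneg (mul_nonneg hA2 hE1) hT2) hD2,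
      mul_nonneg (mul_nonneg (mul_nonneg (mul_nonneg hA2 hE1) hE3) hK.le) hK.le,
      mul_nonneg (mul_nonneg (mul_nonneg hA2 hA3) hE1) hT2,
      mul_nonneg (mul_nonneg (mul_nonneg hA1 hE3) hT2) hD2,
      mul_nonneg (mul_nonneg (mul_nonneg hA1 hE2) hT2) hT2,
      mul_nonneg (mul_nonneg (mul_nonneg (mul_nonneg hA1 hE2) hE3) hK.le) hK.le,
      mul_nonneg (mul_nonneg (mul_nonneg hA1 hA3) hE2) hT2,
      mul_nonneg (mul_nonneg (mul_nonneg hA1 hA2) hE3) hT2]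
  by_contra hc; push Not at hc
  have := mul_neg_of_pos_of_neg hK (show (3 * K - D) * ((1 - g₁) * (1 - g₂) * (1 - g₃) * (D + 3 * lo) + (g₁ * (1 - g₂) * (1 - g₃) + g₂ * (1
          - g₁) * (1 - g₃) + g₃ * (1 - g₁) * (1 - g₂)) * (D + 3 * lo - K) + (g₁ * g₂ * (1 - g₃) + g₁ * g₃ * (1 - g₂) + g₂ * g₃ * (1 - g₁)) * (D + 3 * lo - 2 * K)) - ((3 * K - 3 * lo - D) * D * ((1 - g₁) * (1 - g₂) * (1 - g₃))) < 0 by linarith)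
  linarith

/-- **top cost at the switching point, largest floor** (`g₁` the least gate, `3lo ≤ K`, `2K ≤ 7lo`):
`(lo+Kg₁)·u₀·[(3K−3lo)u₀ + (2K−3lo)u₁] ≤ 3loK(1−g₁)(u₀+u₁)²`.  Degree-8 certificate, 24 products (kit j296246). [this work] -/
theorem ltTop_cost0_max (lo K g₁ g₂ g₃ : ℝ) (hlo : 0 < lo)
    (hK1 : 3 * lo ≤ K) (hK2 : 2 * K ≤ 7 * lo) (hg₁ : lo ≤ K * g₁) (h12 : g₁ ≤ g₂) (h13 : g₁ ≤ g₃) (h11 : g₁ ≤ 1) (h21 : g₂ ≤ 1)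
    (h31 : g₃ ≤ 1) :
    (lo + K * g₁) * (((1 - g₁) * (1 - g₂) * (1 - g₃)) * ((3 * K - 3 * lo) * ((1 - g₁) * (1 - g₂) * (1 - g₃)) + (2 * K - 3 * lo) * (g₁ * (1 - g₂) * (1
          - g₃) + g₂ * (1 - g₁) * (1 - g₃) + g₃ * (1 - g₁) * (1 - g₂))))
      ≤ 3 * lo * K * (1 - g₁) * ((1 - g₁) * (1 - g₂) * (1 - g₃) + (g₁ * (1 - g₂) * (1 - g₃) + g₂ * (1 - g₁) * (1 - g₃) + g₃ * (1 - g₁) * (1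
          - g₂))) ^ 2 := by
  have hK : 0 < K := by linarith
  have hA1 : 0 ≤ K * g₁ - lo := sub_nonneg.2 hg₁
  have hE1 : 0 ≤ 1 - g₁ := sub_nonneg.2 h11
  have hE2 : 0 ≤ 1 - g₂ := sub_nonneg.2 h21
  have hE3 : 0 ≤ 1 - g₃ := sub_nonneg.2 h31
  have h21' : 0 ≤ g₂ - g₁ := sub_nonneg.2 h12
  have h31' : 0 ≤ g₃ - g₁ := sub_nonneg.2 h13
  have hClo : 0 ≤ 7 * lo - 2 * K := by linarith
  have hChi : 0 ≤ K - 3 * lo := by linarith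
  have key : 0 ≤ (3 * lo * K * (1 - g₁) * ((1 - g₁) * (1 - g₂) * (1 - g₃) + (g₁ * (1 - g₂) * (1 - g₃) + g₂ * (1 - g₁) * (1 - g₃) + g₃ * (1 - g₁) * (1
          - g₂))) ^ 2
      - ((lo + K * g₁) * (((1 - g₁) * (1 - g₂) * (1 - g₃)) * ((3 * K - 3 * lo) * ((1 - g₁) * (1 - g₂) * (1 - g₃)) + (2 * K - 3 * lo) * (g₁ * (1
          - g₂) * (1 - g₃) + g₂ * (1 - g₁) * (1 - g₃) + g₃ * (1 - g₁) * (1 - g₂)))))) := by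
    linarith [mul_nonneg (mul_nonneg (mul_nonneg (mul_nonneg (mul_nonneg (mul_nonneg hE1 hE2) hE2) hE3) h31') hK.le) hK.le,
      mul_nonneg (mul_nonneg (mul_nonneg (mul_nonneg (mul_nonneg (mul_nonneg hE1 hE2) hE2) hE3) hE3) hClo) hK.le,
      mul_nonneg (mul_nonneg (mul_nonneg (mul_nonneg (mul_nonneg (mul_nonneg hE1 hE2) hE2) hE3) hE3) hClo) hClo,
      mul_nonneg (mul_nonneg (mul_nonneg (mul_nonneg (mul_nonneg (mul_nonneg hE1 hE1) hE3) hE3) h21') hK.le) hK.le,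
      mul_nonneg (mul_nonneg (mul_nonneg (mul_nonneg (mul_nonneg (mul_nonneg hE1 hE1) hE2) hE3) h31') hK.le) hK.le,
      mul_nonneg (mul_nonneg (mul_nonneg (mul_nonneg (mul_nonneg (mul_nonneg hE1 hE1) hE2) hE3) h21') hK.le) hK.le,
      mul_nonneg (mul_nonneg (mul_nonneg (mul_nonneg (mul_nonneg (mul_nonneg hE1 hE1) hE2) hE3) hE3) hClo) hK.le,
      mul_nonneg (mul_nonneg (mul_nonneg (mul_nonneg (mul_nonneg (mul_nonneg hE1 hE1) hE2) hE3) hE3) hClo) hClo,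
      mul_nonneg (mul_nonneg (mul_nonneg (mul_nonneg (mul_nonneg (mul_nonneg hE1 hE1) hE2) hE2) h31') hK.le) hK.le,
      mul_nonneg (mul_nonneg (mul_nonneg (mul_nonneg (mul_nonneg (mul_nonneg hE1 hE1) hE2) hE2) hE3) hClo) hK.le,
      mul_nonneg (mul_nonneg (mul_nonneg (mul_nonneg (mul_nonneg (mul_nonneg hE1 hE1) hE2) hE2) hE3) hClo) hClo,
      mul_nonneg (mul_nonneg (mul_nonneg (mul_nonneg (mul_nonneg (mul_nonneg (mul_nonneg hE1 hE1) hE2) hE2) hE3) hE3) hChi) hK.le,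
      mul_nonneg (mul_nonneg (mul_nonneg (mul_nonneg (mul_nonneg (mul_nonneg (mul_nonneg hE1 hE1) hE2) hE2) hE3) hE3) hClo) hChi,
      mul_nonneg (mul_nonneg (mul_nonneg (mul_nonneg (mul_nonneg (mul_nonneg hE1 hE1) hE1) hE3) hE3) hClo) hK.le,
      mul_nonneg (mul_nonneg (mul_nonneg (mul_nonneg (mul_nonneg (mul_nonneg hE1 hE1) hE1) hE2) hE3) hClo) hK.le,
      mul_nonneg (mul_nonneg (mul_nonneg (mul_nonneg (mul_nonneg (mul_nonneg hE1 hE1) hE1) hE2) hE2) hClo) hK.le,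
      mul_nonneg (mul_nonneg (mul_nonneg (mul_nonneg (mul_nonneg (mul_nonneg (mul_nonneg (mul_nonneg hE1 hE1) hE1) hE2) hE2) hE3) hE3) hClo) hK.le,
      mul_nonneg (mul_nonneg (mul_nonneg (mul_nonneg (mul_nonneg (mul_nonneg hA1 hE1) hE2) hE2) hE3) h31') hK.le,
      mul_nonneg (mul_nonneg (mul_nonneg (mul_nonneg (mul_nonneg (mul_nonneg hA1 hE1) hE2) hE2) hE3) hE3) hClo,
      mul_nonneg (mul_nonneg (mul_nonneg (mul_nonneg (mul_nonneg (mul_nonneg hA1 hE1) hE1) hE2) hE3) hE3) hK.le,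
      mul_nonneg (mul_nonneg (mul_nonneg (mul_nonneg (mul_nonneg (mul_nonneg hA1 hE1) hE1) hE2) hE3) hE3) hClo,
      mul_nonneg (mul_nonneg (mul_nonneg (mul_nonneg (mul_nonneg (mul_nonneg hA1 hE1) hE1) hE2) hE2) hE3) hK.le,
      mul_nonneg (mul_nonneg (mul_nonneg (mul_nonneg (mul_nonneg (mul_nonneg hA1 hE1) hE1) hE2) hE2) hE3) hClo,
      mul_nonneg (mul_nonneg (mul_nonneg (mul_nonneg (mul_nonneg (mul_nonneg hA1 hA1) hE1) hE2) hE2) hE3) hE3]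
  linarith [key]

end LawDec
end Quant
end Summit.CriticalPhenomena.PercolationContinuityZ3.Theorems
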